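import Summits.CriticalPhenomena.PercolationContinuityZ3.Theorems.PercNearOneGluingNoHeavyLowerTailSahiE3JuntaMeet
import Mathlib.Tactic.Linarith
import Mathlib.Tactic.Ring
import Mathlib.Tactic.FieldSimp
import Mathlib.Tactic.Positivity
import HarnessLib

/-!
# `NoHeavyLowerTail` (crux stmt-CriticalPhenomena-4575), Sahi programme P4 (monotone coupling / transport):
# the tangent conditions of the junta-intersection transfer are LIMITS OF SAHI'S INEQUALITY ONE DIMENSION UP —
# hence "Kahn's Conjecture 5 on `m + 1` coordinates ⟹ `E₃ ≥ 0` in every dimension for every triple with an `m`-junta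
# pairwise intersection"

Support file (cell `prim-l12`, seat P4, generation 3; `--supports stmt-CriticalPhenomena-4575`).  No named facts, no sorries,
no definitions.  Completes `…SahiE3JuntaMeet` (`sahiE3_nonneg_of_mul_junta`: block hypotheses (C3W), (TanA), (TanB) ⟹ `E₃(u,f,g) ≥ 0`
on `W ∪ D` when `f·g` is `W`-determined).

* `tanA_of_sahiC3_insert` — (TanA) for monotone `{0,1}`-valued `t, f*, g*` on the block `W` FOLLOWS from Sahi's inequality
  `E₃ ≥ 0` on the cube `insert e W` (`e ∉ W`, all weights in `[0,1]`, all monotone `{0,1}`-valued triples).  Proof: for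
  `ε ∈ (0,1]` give `e` the weight `ε` and take `u' = 1[e ∈ ·]·t`, `f' = (e ∈ · ? f* : f*g*)`, `g' = g*` (read through `S ↦ S.erase e`);
  splitting along `e` (`ED_insert`) gives EXACTLY `E₃(u',f',g') = ε·Ψ(π + ε(a* − π), b*)` with the block functional
  `Ψ(x,y) = 2X + τxy − τπ − xG − yF` (`X = E_W[t f* g*]`, `τ = E_W t`, `F = E_W[t f*]`, `G = E_W[t g*]`, `π = E_W[f*g*]`,
  `a* = E_W f*`, `b* = E_W g*`), which is affine in `ε` after dividing by `ε`; letting `ε → 0` (`nonneg_of_forall_small`) yields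
  `Ψ(π, b*) ≥ 0`, i.e. (TanA).  (TanB) is the same statement with `f*` and `g*` exchanged.
* **`sahiE3_nonneg_of_mul_junta_of_sahiC3_insert`** — THE PACKAGED TRANSFER: if Sahi's `E₃ ≥ 0` holds for all monotone
  `{0,1}`-valued triples on the cube `insert e W` under every weight vector in `[0,1]` (Kahn's Conjecture 5 on `|W| + 1`
  coordinates), then `E₃(u,f,g) ≥ 0` on EVERY cube `W ∪ D` (`W ∩ D = ∅`) for all monotone `{0,1}`-valued `u, f, g` with `f·g`
  `W`-determined — whatever `D` and the weights are.  ((C3W) is the `e`-independent case of the hypothesis.)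
Reading: a minimal counterexample to Kahn's Conjecture 5 on `{0,1}^k` has all three pairwise intersections of FULL support `k`
(else the transfer from `k' + 1 ≤ k` coordinates applies).  [this work]
-/

noncomputable section

namespace Summit.CriticalPhenomena.PercolationContinuityZ3.Theorems

namespace SahiE3JuntaMeet

open Finset Literature.Probability.Percolation Literature.Probability.Percolation.DecisionTree SahiE3PrincipalMeet

variable {ι : Type*} [DecidableEq ι]

/-- The cube expectation depends only on the weights of the coordinates of the cube. [folklore] -/
theorem ED_congr_weights (W : Finset ι) {p q : ι → ℝ} (h : ∀ i ∈ W, q i = p i) (φ : Finset ι → ℝ) :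
    ED W q φ = ED W p φ := by
  unfold ED wtW
  refine Finset.sum_congr rfl fun S _ => ?_
  rw [Finset.prod_congr rfl fun i hi => by rw [h i hi]]

omit [DecidableEq ι] in
/-- If `c + εL ≥ 0` for every `ε ∈ (0,1]` then `c ≥ 0` (the limit `ε → 0` of an affine function). [folklore] -/
theorem nonneg_of_forall_small (c L : ℝ) (h : ∀ ε : ℝ, 0 < ε → ε ≤ 1 → 0 ≤ c + ε * L) : 0 ≤ c := by
  by_contra hc'
  have hc : c < 0 := lt_of_not_ge hc'
  have h1 := h 1 one_pos le_rfl
  have hL : 0 < L := by linarith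
  have hε : 0 < -c / (2 * L) := div_pos (by linarith) (by linarith)
  have hε1 : -c / (2 * L) ≤ 1 := by
    rw [div_le_one (by linarith)]
    linarith
  have h2 := h _ hε hε1
  have h3 : -c / (2 * L) * L = -c / 2 := by
    field_simp
  rw [h3] at h2
  linarith

/-- Integrating an `e`-independent function over the cube `insert e W` (`e ∉ W`) is integrating over `W`. [folklore] -/
theorem ED_insert_erase (W : Finset ι) {e : ι} (he : e ∉ W) (p : ι → ℝ) (φ : Finset ι → ℝ) :
    ED (insert e W) p (fun S => φ (S.erase e)) = ED W p φ := by
  rw [ED_insert p he]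
  have h1 : ED W p (fun S => φ (S.erase e)) = ED W p φ :=
    ED_congr_sub W p fun S hS => by rw [Finset.erase_eq_of_notMem fun h => he (hS h)]
  have h2 : ED W p (fun S => (fun S => φ (S.erase e)) (insert e S)) = ED W p φ :=
    ED_congr_sub W p fun S hS => by
      show φ ((insert e S).erase e) = φ S
      rw [Finset.erase_insert fun h => he (hS h)]
  rw [h1, h2]
  ring

/-- **(TanA) is a limit of Sahi's inequality one dimension up.**  Let `e ∉ W`, `p ∈ [0,1]^ι`, and `t, fs, gs` monotone
`{0,1}`-valued.  If `E₃(u,f,g) ≥ 0` on the cube `insert e W` for every weight vector in `[0,1]` and all monotone `{0,1}`-valued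
`u, f, g`, then the tangent condition (TanA) of `sahiE3_nonneg_of_mul_junta` holds on `W` for `(t, fs, gs)`:
`E_W gs · E_W[t fs (1 − gs)] ≤ E₃^W(t, fs·gs, gs)`. [this work] -/
theorem tanA_of_sahiC3_insert (W : Finset ι) {e : ι} (he : e ∉ W) {p : ι → ℝ} (hp0 : ∀ i, 0 ≤ p i) (hp1 : ∀ i, p i ≤ 1)
    {t fs gs : Finset ι → ℝ}
    (ht : ∀ ⦃S T : Finset ι⦄, S ⊆ T → t S ≤ t T) (ht01 : ∀ S, t S = 0 ∨ t S = 1)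
    (hfs : ∀ ⦃S T : Finset ι⦄, S ⊆ T → fs S ≤ fs T) (hfs01 : ∀ S, fs S = 0 ∨ fs S = 1)
    (hgs : ∀ ⦃S T : Finset ι⦄, S ⊆ T → gs S ≤ gs T) (hgs01 : ∀ S, gs S = 0 ∨ gs S = 1)
    (hC3 : ∀ q : ι → ℝ, (∀ i, 0 ≤ q i) → (∀ i, q i ≤ 1) → ∀ u f g : Finset ι → ℝ,
      (∀ ⦃S T : Finset ι⦄, S ⊆ T → u S ≤ u T) → (∀ S, u S = 0 ∨ u S = 1) →
      (∀ ⦃S T : Finset ι⦄, S ⊆ T → f S ≤ f T) → (∀ S, f S = 0 ∨ f S = 1) →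
      (∀ ⦃S T : Finset ι⦄, S ⊆ T → g S ≤ g T) → (∀ S, g S = 0 ∨ g S = 1) →
      0 ≤ 2 * ED (insert e W) q (fun S => u S * f S * g S)
          + ED (insert e W) q u * ED (insert e W) q f * ED (insert e W) q g
          - ED (insert e W) q u * ED (insert e W) q (fun S => f S * g S)
          - ED (insert e W) q f * ED (insert e W) q (fun S => u S * g S)
          - ED (insert e W) q g * ED (insert e W) q (fun S => u S * f S)) :
    ED W p gs * ED W p (fun S => t S * fs S * (1 - gs S))
      ≤ 2 * ED W p (fun S => t S * (fs S * gs S) * gs S)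
        + ED W p t * ED W p (fun S => fs S * gs S) * ED W p gs
        - ED W p t * ED W p (fun S => (fs S * gs S) * gs S)
        - ED W p (fun S => fs S * gs S) * ED W p (fun S => t S * gs S)
        - ED W p gs * ED W p (fun S => t S * (fs S * gs S)) := by
  -- pointwise facts
  have ht0 : ∀ S, 0 ≤ t S := fun S => by rcases ht01 S with h | h <;> norm_num [h]
  have hfs0 : ∀ S, 0 ≤ fs S := fun S => by rcases hfs01 S with h | h <;> norm_num [h]
  have hgs0 : ∀ S, 0 ≤ gs S := fun S => by rcases hgs01 S with h | h <;> norm_num [h]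
  have hgs1 : ∀ S, gs S ≤ 1 := fun S => by rcases hgs01 S with h | h <;> norm_num [h]
  have hidem : ∀ S, fs S * gs S * gs S = fs S * gs S := fun S => by rw [mul_assoc, mul_self_of_01 hgs01]
  -- block quantities
  obtain ⟨X, hX⟩ : ∃ x : ℝ, x = ED W p (fun S => t S * fs S * gs S) := ⟨_, rfl⟩
  obtain ⟨τ, hτ⟩ : ∃ x : ℝ, x = ED W p t := ⟨_, rfl⟩
  obtain ⟨F, hF⟩ : ∃ x : ℝ, x = ED W p (fun S => t S * fs S) := ⟨_, rfl⟩
  obtain ⟨G, hG⟩ : ∃ x : ℝ, x = ED W p (fun S => t S * gs S) := ⟨_, rfl⟩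
  obtain ⟨π, hπ⟩ : ∃ x : ℝ, x = ED W p (fun S => fs S * gs S) := ⟨_, rfl⟩
  obtain ⟨aS, haS⟩ : ∃ x : ℝ, x = ED W p fs := ⟨_, rfl⟩
  obtain ⟨bS, hbS⟩ : ∃ x : ℝ, x = ED W p gs := ⟨_, rfl⟩
  -- the goal in block quantities
  have eA : ED W p (fun S => t S * fs S * (1 - gs S)) = F - X := by
    have h : ED W p (fun S => t S * fs S * (1 - gs S)) + ED W p (fun S => t S * fs S * gs S)
        = ED W p (fun S => t S * fs S) := by
      rw [← ED_add]; exact ED_congr_sub W p fun S _ => by ring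
    rw [hF, hX]; linarith
  have eB : ED W p (fun S => t S * (fs S * gs S) * gs S) = X := by
    rw [hX]; exact ED_congr_sub W p fun S _ => by rw [mul_assoc (t S) (fs S * gs S) (gs S), hidem S, ← mul_assoc]
  have eC : ED W p (fun S => (fs S * gs S) * gs S) = π := by
    rw [hπ]; exact ED_congr_sub W p fun S _ => hidem S
  have eD : ED W p (fun S => t S * (fs S * gs S)) = X := by
    rw [hX]; exact ED_congr_sub W p fun S _ => by rw [← mul_assoc]
  rw [eA, eB, eC, eD, ← hτ, ← hπ, ← hG, ← hbS]
  suffices key : 0 ≤ 2 * X + τ * π * bS - τ * π - π * G - bS * F by linarith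
  refine nonneg_of_forall_small _ ((τ * bS - G) * (aS - π)) fun ε hε0 hε1 => ?_
  -- the weight vector giving `e` the weight `ε`
  obtain ⟨q, hq⟩ : ∃ q : ι → ℝ, ∀ i, q i = if i = e then ε else p i := ⟨_, fun i => rfl⟩
  have hq0 : ∀ i, 0 ≤ q i := fun i => by
    rw [hq]; split_ifs
    · exact hε0.le
    · exact hp0 i
  have hq1 : ∀ i, q i ≤ 1 := fun i => by
    rw [hq]; split_ifs
    · exact hε1
    · exact hp1 i
  have hqe : q e = ε := by rw [hq, if_pos rfl]
  have hqW : ∀ i ∈ W, q i = p i := fun i hi => by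
    have hie : i ≠ e := ne_of_mem_of_not_mem hi he
    rw [hq, if_neg hie]
  have hsplit : ∀ φ : Finset ι → ℝ,
      ED (insert e W) q φ = (1 - ε) * ED W p φ + ε * ED W p (fun S => φ (insert e S)) := by
    intro φ
    rw [ED_insert q he φ, hqe, ED_congr_weights W hqW, ED_congr_weights W hqW]
  -- the triple on `insert e W`: `u' = 1[e ∈ ·]·t`, `f' = (e ∈ · ? fs : fs·gs)`, `g' = gs`, read through `S ↦ S.erase e`
  obtain ⟨u', hu'⟩ : ∃ v : Finset ι → ℝ, ∀ S, v S = (if e ∈ S then (1 : ℝ) else 0) * t (S.erase e) :=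
    ⟨_, fun S => rfl⟩
  obtain ⟨f', hf'⟩ : ∃ v : Finset ι → ℝ, ∀ S,
      v S = if e ∈ S then fs (S.erase e) else fs (S.erase e) * gs (S.erase e) := ⟨_, fun S => rfl⟩
  obtain ⟨g', hg'⟩ : ∃ v : Finset ι → ℝ, ∀ S, v S = gs (S.erase e) := ⟨_, fun S => rfl⟩
  have hu'_mono : ∀ ⦃S T : Finset ι⦄, S ⊆ T → u' S ≤ u' T := by
    intro S T hST
    rw [hu', hu']
    by_cases hS : e ∈ S
    · rw [if_pos hS, if_pos (hST hS), one_mul, one_mul]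
      exact ht (Finset.erase_subset_erase e hST)
    · rw [if_neg hS, zero_mul]
      refine mul_nonneg ?_ (ht0 _)
      split_ifs
      · exact zero_le_one
      · exact le_rfl
  have hu'01 : ∀ S, u' S = 0 ∨ u' S = 1 := fun S => by
    rw [hu']
    by_cases hS : e ∈ S
    · rw [if_pos hS, one_mul]; exact ht01 _
    · rw [if_neg hS, zero_mul]; exact Or.inl rfl
  have hfg_le : ∀ R, fs R * gs R ≤ fs R := fun R => (mul_le_mul_of_nonneg_left (hgs1 R) (hfs0 R)).trans_eq (mul_one _)
  have hf'_mono : ∀ ⦃S T : Finset ι⦄, S ⊆ T → f' S ≤ f' T := by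
    intro S T hST
    rw [hf', hf']
    have hmono := Finset.erase_subset_erase e hST
    by_cases hS : e ∈ S
    · rw [if_pos hS, if_pos (hST hS)]
      exact hfs hmono
    · rw [if_neg hS]
      by_cases hT : e ∈ T
      · rw [if_pos hT]
        exact (hfg_le _).trans (hfs hmono)
      · rw [if_neg hT]
        exact mul_le_mul (hfs hmono) (hgs hmono) (hgs0 _) (hfs0 _)
  have hf'01 : ∀ S, f' S = 0 ∨ f' S = 1 := fun S => by
    rw [hf']
    split_ifs
    · exact hfs01 _
    · rcases hfs01 (S.erase e) with h | h <;> rcases hgs01 (S.erase e) with h' | h' <;> norm_num [h, h']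
  have hg'_mono : ∀ ⦃S T : Finset ι⦄, S ⊆ T → g' S ≤ g' T := fun S T hST => by
    rw [hg', hg']; exact hgs (Finset.erase_subset_erase e hST)
  have hg'01 : ∀ S, g' S = 0 ∨ g' S = 1 := fun S => by rw [hg']; exact hgs01 _
  have h := hC3 q hq0 hq1 u' f' g' hu'_mono hu'01 hf'_mono hf'01 hg'_mono hg'01
  simp only [hsplit] at h
  -- the fourteen block integrals
  have her : ∀ S, S ⊆ W → S.erase e = S := fun S hS => Finset.erase_eq_of_notMem fun h => he (hS h)
  have hei : ∀ S, S ⊆ W → (insert e S).erase e = S := fun S hS => Finset.erase_insert fun h => he (hS h)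
  have hnot : ∀ S, S ⊆ W → e ∉ S := fun S hS h => he (hS h)
  have hu'0 : ∀ S, S ⊆ W → u' S = 0 := fun S hS => by rw [hu', if_neg (hnot S hS), zero_mul]
  have hu'1 : ∀ S, S ⊆ W → u' (insert e S) = t S := fun S hS => by
    rw [hu', if_pos (Finset.mem_insert_self e S), one_mul, hei S hS]
  have hf'0 : ∀ S, S ⊆ W → f' S = fs S * gs S := fun S hS => by rw [hf', if_neg (hnot S hS), her S hS]
  have hf'1 : ∀ S, S ⊆ W → f' (insert e S) = fs S := fun S hS => by
    rw [hf', if_pos (Finset.mem_insert_self e S), hei S hS]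
  have hg'0 : ∀ S, S ⊆ W → g' S = gs S := fun S hS => by rw [hg', her S hS]
  have hg'1 : ∀ S, S ⊆ W → g' (insert e S) = gs S := fun S hS => by rw [hg', hei S hS]
  have T1 : ED W p (fun S => u' S * f' S * g' S) = 0 := by
    rw [← ED_const W p 0]; exact ED_congr_sub W p fun S hS => by rw [hu'0 S hS, zero_mul, zero_mul]
  have T1' : ED W p (fun S => u' (insert e S) * f' (insert e S) * g' (insert e S)) = X := by
    rw [hX]; exact ED_congr_sub W p fun S hS => by rw [hu'1 S hS, hf'1 S hS, hg'1 S hS]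
  have T2 : ED W p u' = 0 := by
    rw [← ED_const W p 0]; exact ED_congr_sub W p fun S hS => hu'0 S hS
  have T2' : ED W p (fun S => u' (insert e S)) = τ := by
    rw [hτ]; exact ED_congr_sub W p fun S hS => hu'1 S hS
  have T3 : ED W p f' = π := by
    rw [hπ]; exact ED_congr_sub W p fun S hS => hf'0 S hS
  have T3' : ED W p (fun S => f' (insert e S)) = aS := by
    rw [haS]; exact ED_congr_sub W p fun S hS => hf'1 S hS
  have T4 : ED W p g' = bS := by
    rw [hbS]; exact ED_congr_sub W p fun S hS => hg'0 S hS
  have T4' : ED W p (fun S => g' (insert e S)) = bS := by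
    rw [hbS]; exact ED_congr_sub W p fun S hS => hg'1 S hS
  have T5 : ED W p (fun S => f' S * g' S) = π := by
    rw [hπ]; exact ED_congr_sub W p fun S hS => by rw [hf'0 S hS, hg'0 S hS, hidem S]
  have T5' : ED W p (fun S => f' (insert e S) * g' (insert e S)) = π := by
    rw [hπ]; exact ED_congr_sub W p fun S hS => by rw [hf'1 S hS, hg'1 S hS]
  have T6 : ED W p (fun S => u' S * g' S) = 0 := by
    rw [← ED_const W p 0]; exact ED_congr_sub W p fun S hS => by rw [hu'0 S hS, zero_mul]
  have T6' : ED W p (fun S => u' (insert e S) * g' (insert e S)) = G := by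
    rw [hG]; exact ED_congr_sub W p fun S hS => by rw [hu'1 S hS, hg'1 S hS]
  have T7 : ED W p (fun S => u' S * f' S) = 0 := by
    rw [← ED_const W p 0]; exact ED_congr_sub W p fun S hS => by rw [hu'0 S hS, zero_mul]
  have T7' : ED W p (fun S => u' (insert e S) * f' (insert e S)) = F := by
    rw [hF]; exact ED_congr_sub W p fun S hS => by rw [hu'1 S hS, hf'1 S hS]
  rw [T1, T1', T2, T2', T3, T3', T4, T4', T5, T5', T6, T6', T7, T7'] at h
  have hval : 2 * ((1 - ε) * 0 + ε * X) + ((1 - ε) * 0 + ε * τ) * ((1 - ε) * π + ε * aS) * ((1 - ε) * bS + ε * bS)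
      - ((1 - ε) * 0 + ε * τ) * ((1 - ε) * π + ε * π) - ((1 - ε) * π + ε * aS) * ((1 - ε) * 0 + ε * G)
      - ((1 - ε) * bS + ε * bS) * ((1 - ε) * 0 + ε * F)
      = ε * (2 * X + τ * π * bS - τ * π - π * G - bS * F + ε * ((τ * bS - G) * (aS - π))) := by ring
  rw [hval] at h
  exact (mul_nonneg_iff_of_pos_left hε0).1 h

/-- **The packaged junta-intersection transfer.**  If Sahi's `E₃ ≥ 0` holds for all monotone `{0,1}`-valued triples on the cube
`insert e W` (`e ∉ W`) under every weight vector in `[0,1]` — Kahn's Conjecture 5 on `|W| + 1` coordinates — then on every cube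
`W ∪ D` (`W ∩ D = ∅`, any weights `p ∈ [0,1]`) and for all monotone `{0,1}`-valued `u, f, g` with `f·g` determined by the block `W`
(`f(Z ∪ T)g(Z ∪ T) = f(D ∪ T)g(D ∪ T)`, `Z ⊆ D`, `T ⊆ W`):  `E₃(u,f,g) ≥ 0`.  [this work; `sahiE3_nonneg_of_mul_junta` with (C3W) the
`e`-independent case of the hypothesis and (TanA), (TanB) from `tanA_of_sahiC3_insert`] -/
theorem sahiE3_nonneg_of_mul_junta_of_sahiC3_insert (W D : Finset ι) (hWD : Disjoint W D) {e : ι} (he : e ∉ W)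
    {p : ι → ℝ} (hp0 : ∀ i, 0 ≤ p i) (hp1 : ∀ i, p i ≤ 1) {u f g : Finset ι → ℝ}
    (hu : ∀ ⦃S T : Finset ι⦄, S ⊆ T → u S ≤ u T) (hu01 : ∀ S, u S = 0 ∨ u S = 1)
    (hf : ∀ ⦃S T : Finset ι⦄, S ⊆ T → f S ≤ f T) (hf01 : ∀ S, f S = 0 ∨ f S = 1)
    (hg : ∀ ⦃S T : Finset ι⦄, S ⊆ T → g S ≤ g T) (hg01 : ∀ S, g S = 0 ∨ g S = 1)
    (hfg : ∀ Z, Z ⊆ D → ∀ T, T ⊆ W → f (Z ∪ T) * g (Z ∪ T) = f (D ∪ T) * g (D ∪ T))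
    (hC3 : ∀ q : ι → ℝ, (∀ i, 0 ≤ q i) → (∀ i, q i ≤ 1) → ∀ u f g : Finset ι → ℝ,
      (∀ ⦃S T : Finset ι⦄, S ⊆ T → u S ≤ u T) → (∀ S, u S = 0 ∨ u S = 1) →
      (∀ ⦃S T : Finset ι⦄, S ⊆ T → f S ≤ f T) → (∀ S, f S = 0 ∨ f S = 1) →
      (∀ ⦃S T : Finset ι⦄, S ⊆ T → g S ≤ g T) → (∀ S, g S = 0 ∨ g S = 1) →
      0 ≤ 2 * ED (insert e W) q (fun S => u S * f S * g S)
          + ED (insert e W) q u * ED (insert e W) q f * ED (insert e W) q g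
          - ED (insert e W) q u * ED (insert e W) q (fun S => f S * g S)
          - ED (insert e W) q f * ED (insert e W) q (fun S => u S * g S)
          - ED (insert e W) q g * ED (insert e W) q (fun S => u S * f S)) :
    0 ≤ 2 * ED (W ∪ D) p (fun S => u S * f S * g S)
          + ED (W ∪ D) p u * ED (W ∪ D) p f * ED (W ∪ D) p g
          - ED (W ∪ D) p u * ED (W ∪ D) p (fun S => f S * g S)
          - ED (W ∪ D) p f * ED (W ∪ D) p (fun S => u S * g S)
          - ED (W ∪ D) p g * ED (W ∪ D) p (fun S => u S * f S) := by
  have hfs : ∀ ⦃S T : Finset ι⦄, S ⊆ T → f (D ∪ S) ≤ f (D ∪ T) :=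
    fun S T hST => hf (Finset.union_subset_union (Finset.Subset.refl D) hST)
  have hgs : ∀ ⦃S T : Finset ι⦄, S ⊆ T → g (D ∪ S) ≤ g (D ∪ T) :=
    fun S T hST => hg (Finset.union_subset_union (Finset.Subset.refl D) hST)
  refine sahiE3_nonneg_of_mul_junta W D hWD hp0 hp1 hu hu01 hf hf01 hg hg01 hfg ?_ ?_ ?_
  · -- (C3W): the hypothesis at `e`-independent functions
    intro t ht ht01
    have hte : ∀ ⦃S T : Finset ι⦄, S ⊆ T → t (S.erase e) ≤ t (T.erase e) :=
      fun S T hST => ht (Finset.erase_subset_erase e hST)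
    have hfe : ∀ ⦃S T : Finset ι⦄, S ⊆ T → f (D ∪ S.erase e) ≤ f (D ∪ T.erase e) :=
      fun S T hST => hfs (Finset.erase_subset_erase e hST)
    have hge : ∀ ⦃S T : Finset ι⦄, S ⊆ T → g (D ∪ S.erase e) ≤ g (D ∪ T.erase e) :=
      fun S T hST => hgs (Finset.erase_subset_erase e hST)
    have h := hC3 p hp0 hp1 (fun S => t (S.erase e)) (fun S => f (D ∪ S.erase e)) (fun S => g (D ∪ S.erase e))
      hte (fun S => ht01 _) hfe (fun S => hf01 _) hge (fun S => hg01 _)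
    have E1 := ED_insert_erase W he p (fun S => t S * f (D ∪ S) * g (D ∪ S))
    have E2 := ED_insert_erase W he p t
    have E3 := ED_insert_erase W he p (fun S => f (D ∪ S))
    have E4 := ED_insert_erase W he p (fun S => g (D ∪ S))
    have E5 := ED_insert_erase W he p (fun S => f (D ∪ S) * g (D ∪ S))
    have E6 := ED_insert_erase W he p (fun S => t S * g (D ∪ S))
    have E7 := ED_insert_erase W he p (fun S => t S * f (D ∪ S))
    beta_reduce at E1 E2 E3 E4 E5 E6 E7
    rw [E1, E2, E3, E4, E5, E6, E7] at h
    exact h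
  · -- (TanA)
    intro t ht ht01
    exact tanA_of_sahiC3_insert W he hp0 hp1 ht ht01 (fs := fun S => f (D ∪ S)) (gs := fun S => g (D ∪ S))
      hfs (fun S => hf01 _) hgs (fun S => hg01 _) hC3
  · -- (TanB): (TanA) with the roles of `f` and `g` exchanged
    intro t ht ht01
    have h := tanA_of_sahiC3_insert W he hp0 hp1 ht ht01 (fs := fun S => g (D ∪ S)) (gs := fun S => f (D ∪ S))
      hgs (fun S => hg01 _) hfs (fun S => hf01 _) hC3
    have c1 : ED W p (fun S => t S * (g (D ∪ S) * f (D ∪ S)) * f (D ∪ S))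
        = ED W p (fun S => t S * f (D ∪ S) * (f (D ∪ S) * g (D ∪ S))) := ED_congr_sub W p fun S _ => by ring
    have c2 : ED W p (fun S => g (D ∪ S) * f (D ∪ S)) = ED W p (fun S => f (D ∪ S) * g (D ∪ S)) :=
      ED_congr_sub W p fun S _ => by ring
    have c3 : ED W p (fun S => g (D ∪ S) * f (D ∪ S) * f (D ∪ S))
        = ED W p (fun S => f (D ∪ S) * (f (D ∪ S) * g (D ∪ S))) := ED_congr_sub W p fun S _ => by ring
    have c4 : ED W p (fun S => t S * (g (D ∪ S) * f (D ∪ S)))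
        = ED W p (fun S => t S * (f (D ∪ S) * g (D ∪ S))) := ED_congr_sub W p fun S _ => by ring
    rw [c1, c2, c3, c4] at h
    linarith

end SahiE3JuntaMeet

end Summit.CriticalPhenomena.PercolationContinuityZ3.Theorems

end
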